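import Mathlib
import Summits.Ventures.DiscreteObjects.Mahler.FourTermMeasureBound

/-!
# Sparse reciprocal polynomials II: `M ≥ √2` for cyclotomic-free reciprocal trinomials
(venture `DiscreteObjects`, target L)

Cell `pub-namedobj`, seat `pub-namedobj-mahler-g24`. Framing: lottery ticket; floor = certified
bounds/negative ranges.

The trinomials `P = x^{2m} + c x^m + s` (`m > 0`, `s = ±1`; the reciprocal ones are those with `s = 1`),
by the resultant step `abs_pow_le_pow_mul_measure_pow_of_resultant` of `FourTermMeasureBound` with the
auxiliary polynomials `x^{2m} + s` (congruence `P ≡ x^{2m} + s (mod c)`) and `x^{4m} - 1` (`c` even):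

* `abs_le_two_mul_measure_trinomial` — `|c| ≤ 2 M(P)` for cyclotomic-free `P`;
* `abs_le_measure_sq_trinomial` — `|c| ≤ M(P)²` for cyclotomic-free `P` with `c` even;
* `not_cyclotomicFree_trinomial_of_abs_le_one` — for `s = 1` and `|c| ≤ 1`, `P` is `x^{2m} + 1`,
  `Φ₃(x^m)` or `Φ₆(x^m)` and vanishes at a root of unity;
* `sqrt_two_le_measure_trinomial` — **`M(x^{2m} + c x^m + 1) ≥ √2`** whenever it is cyclotomic-free.

Elementary (these trinomials are `R(x^m)` with `R` quadratic); recorded in resultant form for the quadrinomial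
assembly.  In print, the sharp statement for quadrinomials is [Dobrowolski2006] E. Dobrowolski, Acta Arith.
123 (2006), Prop. 2: a monic quadrinomial with `f(0) ≠ 0` that is not a product of cyclotomic polynomials has
`M(f) ≥ θ₀`; this line of files is a kernel formalisation of that circle of results (REPLICATION).
-/

namespace Summit.Ventures.DiscreteObjects.Mahler

open Polynomial

/-! ### Reciprocal trinomials `x^{2m} + c x^m + s` -/

section Trinomial

variable {m : ℕ} {c s : ℤ}

/-- The trinomial `x^{2m} + c x^m + s` is monic of degree `2m` (`0 < m`). -/
theorem recTrinomial_monic_natDegree (hm : 0 < m) (c s : ℤ) :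
    (X ^ (2 * m) + C c * X ^ m + C s : ℤ[X]).Monic ∧ (X ^ (2 * m) + C c * X ^ m + C s : ℤ[X]).natDegree = 2 * m := by
  have hR : (C c * X ^ m + C s : ℤ[X]).degree < (2 * m : ℕ) := by
    refine lt_of_le_of_lt (degree_add_le _ _) (max_lt ?_ ?_)
    · exact lt_of_le_of_lt (degree_C_mul_X_pow_le _ _) (by exact_mod_cast (show m < 2 * m by omega))
    · exact lt_of_le_of_lt degree_C_le (by exact_mod_cast (show 0 < 2 * m by omega))
  have he : (X ^ (2 * m) + C c * X ^ m + C s : ℤ[X]) = X ^ (2 * m) + (C c * X ^ m + C s) := by ring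
  have hXd : (X ^ (2 * m) : ℤ[X]).degree = (2 * m : ℕ) := degree_X_pow _
  rw [he]
  refine ⟨(monic_X_pow _).add_of_left (by rwa [hXd]), ?_⟩
  rw [natDegree_add_eq_left_of_degree_lt (by rwa [hXd]), natDegree_X_pow]

/-- **`|c| ≤ 2 M(P)`** for a cyclotomic-free trinomial `P = x^{2m} + c x^m + s` (`s = ±1`, `m > 0`):
congruence `P ≡ x^{2m} + s (mod c)`, auxiliary `x^{2m} + s`. -/
theorem abs_le_two_mul_measure_trinomial (hm : 0 < m) (hs : s = 1 ∨ s = -1)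
    (hcf : ∀ k : ℕ, 0 < k → ¬ cyclotomic k ℤ ∣ (X ^ (2 * m) + C c * X ^ m + C s : ℤ[X])) :
    (|c| : ℝ) ≤ 2 * intMahlerMeasure (X ^ (2 * m) + C c * X ^ m + C s : ℤ[X]) := by
  obtain ⟨hmon, hdeg⟩ := recTrinomial_monic_natDegree hm c s
  set P : ℤ[X] := X ^ (2 * m) + C c * X ^ m + C s with hPdef
  have hP0 : P ≠ 0 := hmon.ne_zero
  set n := 2 * m with hn
  have hnpos : 0 < n := by omega
  have hG : (X ^ n + C s : ℤ[X]) = C c * (-(X ^ m)) + P * 1 := by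
    rw [hPdef]; ring
  have hGdeg : (X ^ n + C s : ℤ[X]).natDegree ≤ n := by
    rw [natDegree_X_pow_add_C]
  have hne : P.resultant (X ^ n + C s) P.natDegree n ≠ 0 := by
    refine resultant_ne_zero_of_cyclotomicFree (L := 2 * n) hP0 hcf hGdeg (by omega) ?_
    intro z hz
    simp only [Polynomial.map_add, Polynomial.map_pow, map_X, eq_intCast, Polynomial.map_intCast,
      eval_add, eval_pow, eval_X, eval_intCast] at hz
    have hz' : z ^ n = -(s : ℂ) := eq_neg_of_add_eq_zero_left hz
    rw [pow_mul', hz', neg_sq]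
    rcases hs with h | h <;> simp [h]
  have hroot : ∀ α : ℂ, ‖((X ^ n + C s : ℤ[X]).map (Int.castRingHom ℂ)).eval α‖ ≤ 2 * max 1 ‖α‖ ^ n := by
    intro α
    simp only [Polynomial.map_add, Polynomial.map_pow, map_X, eq_intCast, Polynomial.map_intCast,
      eval_add, eval_pow, eval_X, eval_intCast]
    exact norm_pow_add_le_two_mul α (s : ℂ) (norm_intCast_le_one_of_sign hs) n
  have h := abs_pow_le_pow_mul_measure_pow_of_resultant (K := 2) hG
    (by rw [natDegree_one, hdeg]; omega) hGdeg hne hroot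
  rw [hdeg, ← mul_pow] at h
  have hM0 : 0 ≤ 2 * intMahlerMeasure P := by
    have := one_le_intMahlerMeasure hP0; linarith
  exact le_of_pow_le_pow_left₀ (by omega) hM0 h

/-- **`|c| ≤ M(P)²`** for a cyclotomic-free trinomial `P = x^{2m} + c x^m + s` with `c` EVEN (`s = ±1`,
`m > 0`): with `c = 2e`, `x^{4m} - 1 = 4e · x^m (e x^m + s) + P · (P - 4e x^m - 2s)`. -/
theorem abs_le_measure_sq_trinomial (hm : 0 < m) (hs : s = 1 ∨ s = -1) (hc : Even c)
    (hcf : ∀ k : ℕ, 0 < k → ¬ cyclotomic k ℤ ∣ (X ^ (2 * m) + C c * X ^ m + C s : ℤ[X])) :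
    (|c| : ℝ) ≤ intMahlerMeasure (X ^ (2 * m) + C c * X ^ m + C s : ℤ[X]) ^ 2 := by
  obtain ⟨hmon, hdeg⟩ := recTrinomial_monic_natDegree hm c s
  set P : ℤ[X] := X ^ (2 * m) + C c * X ^ m + C s with hPdef
  have hP0 : P ≠ 0 := hmon.ne_zero
  set n := 2 * m with hn
  have hnpos : 0 < n := by omega
  obtain ⟨e, he⟩ := hc
  have hss : s * s = 1 := by rcases hs with h | h <;> simp [h]
  have hCs : (C s : ℤ[X]) * C s = 1 := by rw [← map_mul, hss, map_one]
  have hG : (X ^ (2 * n) - 1 : ℤ[X]) =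
      C (4 * e) * (X ^ m * (C e * X ^ m + C s)) + P * (P - C (4 * e) * X ^ m - C (2 * s)) := by
    rw [hPdef, he]
    simp only [map_add, map_mul, map_ofNat]
    linear_combination hCs
  have hGdeg : (X ^ (2 * n) - 1 : ℤ[X]).natDegree ≤ 2 * n := by
    rw [← C_1, natDegree_X_pow_sub_C]
  have hne : P.resultant (X ^ (2 * n) - 1) P.natDegree (2 * n) ≠ 0 :=
    resultant_X_pow_sub_one_ne_zero hP0 hcf (by omega)
  have hHdeg : (P - C (4 * e) * X ^ m - C (2 * s)).natDegree + P.natDegree ≤ 2 * n := by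
    have h1 : (P - C (4 * e) * X ^ m - C (2 * s)).natDegree ≤ n := by
      refine (natDegree_sub_le _ _).trans (max_le ((natDegree_sub_le _ _).trans (max_le ?_ ?_)) ?_)
      · rw [hdeg]
      · exact (natDegree_C_mul_le _ _).trans (by rw [natDegree_X_pow]; omega)
      · rw [natDegree_C]; omega
    rw [hdeg]; omega
  have hroot : ∀ α : ℂ, ‖((X ^ (2 * n) - 1 : ℤ[X]).map (Int.castRingHom ℂ)).eval α‖ ≤
      2 * max 1 ‖α‖ ^ (2 * n) := by
    intro α
    simp only [Polynomial.map_sub, Polynomial.map_pow, map_X, Polynomial.map_one, eval_sub, eval_pow,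
      eval_X, eval_one]
    have := norm_pow_add_le_two_mul α (-1) (by simp) (2 * n)
    rwa [← sub_eq_add_neg] at this
  have h := abs_pow_le_pow_mul_measure_pow_of_resultant (K := 2) hG hHdeg hGdeg hne hroot
  rw [hdeg, pow_mul (intMahlerMeasure P) 2 n, ← mul_pow] at h
  have hM0 : 0 ≤ 2 * intMahlerMeasure P ^ 2 := by positivity
  have h2 := le_of_pow_le_pow_left₀ (by omega : n ≠ 0) hM0 h
  have h4 : (|((4 : ℤ) * e : ℤ)| : ℝ) = 4 * |(e : ℝ)| := by
    push_cast; rw [abs_mul]; norm_num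
  have h5 : (|c| : ℝ) = 2 * |(e : ℝ)| := by
    rw [he]; push_cast; rw [← two_mul, abs_mul, abs_two]
  rw [h4] at h2
  rw [h5]
  linarith

/-- For `|c| ≤ 1` the RECIPROCAL trinomial `x^{2m} + c x^m + 1` (`m > 0`) is not cyclotomic-free:
it is `x^{2m} + 1`, `Φ₃(x^m)` or `Φ₆(x^m)`, so every root `α` has `α^{4m} = 1` resp. `α^{6m} = 1`. -/
theorem not_cyclotomicFree_trinomial_of_abs_le_one (hm : 0 < m) (hc : |c| ≤ 1) :
    ¬ ∀ k : ℕ, 0 < k → ¬ cyclotomic k ℤ ∣ (X ^ (2 * m) + C c * X ^ m + C 1 : ℤ[X]) := by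
  intro hcf
  obtain ⟨hmon, hdeg⟩ := recTrinomial_monic_natDegree hm c 1
  set P : ℤ[X] := X ^ (2 * m) + C c * X ^ m + C 1 with hPdef
  have hP0 : P ≠ 0 := hmon.ne_zero
  have hinj : Function.Injective (Int.castRingHom ℂ) := (Int.castRingHom ℂ).injective_int
  -- a complex root `z` of `P`
  have hd' : 0 < (P.map (Int.castRingHom ℂ)).degree := by
    rw [degree_map_eq_of_injective hinj, degree_eq_natDegree hP0, hdeg]
    exact_mod_cast (show 0 < 2 * m by omega)
  obtain ⟨z, hz⟩ := Complex.exists_root hd'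
  have hz' : aeval z P = 0 := by
    rw [IsRoot.def, eval_map, ← algebraMap_int_eq, ← aeval_def] at hz
    exact hz
  have hzeq : z ^ (2 * m) + (c : ℂ) * z ^ m + 1 = 0 := by
    have h := hz'
    simp only [hPdef, map_add, map_mul, map_pow, aeval_X, eq_intCast, map_intCast, map_one] at h
    exact h
  by_cases hc0 : c = 0
  · -- `z^{2m} = -1`, so `z^{4m} = 1`
    refine pow_ne_one_of_cyclotomicFree hcf hz' (show 0 < 2 * (2 * m) by omega) ?_
    rw [hc0, Int.cast_zero, zero_mul, add_zero] at hzeq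
    rw [pow_mul', eq_neg_of_add_eq_zero_left hzeq, neg_sq, one_pow]
  · -- `c = ±1`: `(y - c)(y² + c y + 1) = y³ - c`, so `z^{3m} = c` and `z^{6m} = 1`
    have hc1 : c = 1 ∨ c = -1 := by obtain ⟨h1, h2⟩ := abs_le.mp hc; omega
    have hcc : c * c = 1 := by rcases hc1 with h | h <;> simp [h]
    have hc2 : (c : ℂ) * c = 1 := by exact_mod_cast hcc
    refine pow_ne_one_of_cyclotomicFree hcf hz' (show 0 < 6 * m by omega) ?_
    have e6 : z ^ (6 * m) = (z ^ m) ^ 6 := by rw [← pow_mul, mul_comm]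
    have e2 : z ^ (2 * m) = (z ^ m) ^ 2 := by rw [← pow_mul, mul_comm]
    rw [e2] at hzeq
    rw [e6]
    linear_combination ((z ^ m - c) * ((z ^ m) ^ 3 + c)) * hzeq + (z ^ m * ((z ^ m) ^ 3 + c) + 1) * hc2

/-- **`M(P) ≥ √2` for every cyclotomic-free reciprocal trinomial `P = x^{2m} + c x^m + 1`** (`m > 0`,
`c ∈ ℤ`): `|c| ≤ 1` is impossible, `c` even gives `M² ≥ |c| ≥ 2`, `c` odd gives `M ≥ |c|/2 ≥ 3/2`. -/
theorem sqrt_two_le_measure_trinomial (hm : 0 < m)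
    (hcf : ∀ k : ℕ, 0 < k → ¬ cyclotomic k ℤ ∣ (X ^ (2 * m) + C c * X ^ m + C 1 : ℤ[X])) :
    Real.sqrt 2 ≤ intMahlerMeasure (X ^ (2 * m) + C c * X ^ m + C 1 : ℤ[X]) := by
  have h1 : (1 : ℤ) = 1 ∨ (1 : ℤ) = -1 := Or.inl rfl
  have hM1 : 1 ≤ intMahlerMeasure (X ^ (2 * m) + C c * X ^ m + C 1 : ℤ[X]) :=
    one_le_intMahlerMeasure (recTrinomial_monic_natDegree hm c 1).1.ne_zero
  have heven := fun hc : Even c => abs_le_measure_sq_trinomial hm h1 hc hcf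
  have hodd' := abs_le_two_mul_measure_trinomial hm h1 hcf
  set M := intMahlerMeasure (X ^ (2 * m) + C c * X ^ m + C 1 : ℤ[X]) with hM
  have hc2 : 2 ≤ |c| := by
    by_contra h
    have h' : |c| ≤ 1 := by have := Int.lt_iff_add_one_le.mp (not_le.mp h); linarith
    exact not_cyclotomicFree_trinomial_of_abs_le_one hm h' hcf
  rcases Int.even_or_odd c with hev | hodd
  · have h := heven hev
    have h2 : (2 : ℝ) ≤ M ^ 2 := le_trans (by exact_mod_cast hc2) h
    calc Real.sqrt 2 ≤ Real.sqrt (M ^ 2) := Real.sqrt_le_sqrt h2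
      _ = M := Real.sqrt_sq (by linarith)
  · have hc3 : 3 ≤ |c| := by
      rcases hodd with ⟨k, hk⟩
      rcases abs_choice c with h | h <;> rw [h] at hc2 ⊢ <;> omega
    have h3 : (3 : ℝ) ≤ 2 * M := le_trans (by exact_mod_cast hc3) hodd'
    have hs2 : Real.sqrt 2 < 3 / 2 := by
      rw [show (3 : ℝ) / 2 = Real.sqrt ((3 / 2) ^ 2) by rw [Real.sqrt_sq (by norm_num)]]
      exact Real.sqrt_lt_sqrt (by norm_num) (by norm_num)
    linarith

end Trinomial

end Summit.Ventures.DiscreteObjects.Mahler
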